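import Mathlib
import HarnessLib

/-!
# Lefèvre's algorithm: the points of a regular grid close to a segment (three-distance configurations)

V. Lefèvre, *New Results on the Distance between a Segment and ℤ². Application to the Exact Rounding*,
17th IEEE Symposium on Computer Arithmetic (ARITH-17), 2005, pp. 68–75 [Lefevre2005] — the kernel of the
Lefèvre-type exhaustive searches for the hardest-to-round arguments of the elementary functions in
binary64 (Lefèvre–Muller 2001; CORE-MATH / BaCSeL's degree-1 stage; [Lefevre1999] is the first version,
which only returned the lower bound). On each small sub-domain the function is replaced by a segment
`y = b - a·x`, `0 ≤ x < N`, and one asks for the integers `k ∈ ⟦0, N-1⟧` with `{b - k·a} < d₀`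
(`{·}` = positive fractional part = `Int.fract`), [Lefevre2005, §2].

## What is here (all statements are over any linearly ordered field with a floor function; `ℚ` computes)

* §2.2 of the paper, as the predicate `IsConfig a u v x y`: the `n = u + v` points `0·a, 1·a, …, (n-1)·a`
  modulo 1 split `[0,1)` into `u` intervals of length `x` (lower boundaries: the points of index `< u`) and
  `v` intervals of length `y` (lower boundaries: indices `u … n-1`), with `u·x + v·y = 1` ("for any bracket:
  ux + vy = 1"), `x = {v·a}`, `1 - y = {u·a}`. We phrase "the point of index `k` is the lower boundary of an
  interval of length `ℓ(k)` containing no other point" as the GAP inequality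
  `ℓ(k) ≤ {(k' - k)·a}` for all `k' ≠ k` below `n` (`IsConfig.gap`). PROVED: the two transitions of the
  paper's induction (`IsConfig.splitX`: when `y < x` every interval of length `x` splits into `x - y` and `y`,
  giving `(u, v+u, x-y, y)`; `IsConfig.splitY` symmetrically), the initial configuration, and
  `{(u+v)·a} = x - y` resp. `x - y + 1` (`fract_n_of_lt/gt`). This is the two-length case of the
  three-distance theorem as used in [Lefevre2005, §2.2]; the general three-distance theorem is NOT stated here.
* §2.3, **Algorithm 1 verbatim** (`algorithm1`, with its two inner `while` loops `loopY`, `loopX`, the body of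
  the "unconditional loop" `body`, and the loop `loop`; subtractive version — Algorithm 2 (divisions, §3) is an
  optimisation with the same output and is NOT transcribed):
  ```
  Algorithm 1 — Returns the first value r ∈ ⟦0, N-1⟧ such that {b - r.a} < d₀ if there is such an
  integer, else an integer larger or equal to N.
    x = {a}; y = 1 - {a}; d = {b}; u = v = 1; r = 0;
    if (d < d₀) return 0
    Unconditional loop:
      if (d < x)
        while (x < y)
          if (u + v ≥ N) return N
          y = y - x; u = u + v;
        if (u + v ≥ N) return N
        x = x - y;
        if (d ≥ x) r = r + v;
        v = v + u;
      else
        d = d - x;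
        if (d < d₀) return r + u
        while (y < x)
          if (u + v ≥ N) return N
          x = x - y; v = v + u;
        if (u + v ≥ N) return N
        y = y - x;
        if (d < x) r = r + u;
        u = u + v;
  ```
  Loops are written with an explicit iteration bound ("fuel") `N`; since `u + v` increases at every
  iteration and every iteration first tests `u + v ≥ N`, the bound is never reached (`loopY_spec`,
  `loopX_spec`, `loop_spec` prove this: they only ever need fuel `≥ N - (u+v)`).
* **THEOREM (the caption of Algorithm 1), PROVED with no side condition** (`algorithm1_spec`): writing
  `r := algorithm1 a b d₀ N`, if `r < N` then `{b - r·a} < d₀`, and `{b - k·a} ≥ d₀` for every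
  `k < min r N`. Casual equalities (`{k·a} = 0`, excluded in §2.2 and discussed in §2.4: "we must return a
  value r larger or equal to N, and this is exactly what the algorithm does") are covered: once a length
  vanishes the points repeat with period `u + v` and the algorithm runs to `N` (`Degenerate`, `loop_spec`).
  Corollary `le_algorithm1_iff`: `N ≤ algorithm1 a b d₀ N ↔ ∀ k < N, d₀ ≤ {b - k·a}` — the "lower bound /
  no point of the grid is close to the segment" test of [Lefevre1999] that the worst-case searches run on
  every sub-domain, now decidable by evaluation (see the `example` at the end, closed by `decide`).

Design: exact arithmetic in an arbitrary `K` (the paper's §2.4 fixed-point/floating-point representation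
of the lengths is an implementation matter and is NOT modelled); indices are natural numbers; the point of
index `k` is `{k·a}` and the distance from the point of index `k` to `b` (going right, on the circle) is
`{b - k·a}`. Nothing here is specific to floating point: the reduction of a function on a sub-domain to a
segment (Taylor, error terms folded into `d₀`) is the caller's obligation [Lefevre2005, §1, §2.3].
-/

namespace Literature.ComputerArithmetic.Lefevre2005

variable {K : Type*} [Field K] [LinearOrder K] [IsStrictOrderedRing K] [FloorRing K]

section FractToolkit

/-- `{p + q} = {p} + {q}` when the sum of the fractional parts is `< 1`. [folklore] -/
private theorem fract_add_of_lt {p q : K} (h : Int.fract p + Int.fract q < 1) :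
    Int.fract (p + q) = Int.fract p + Int.fract q := by
  rw [Int.fract_eq_iff]
  refine ⟨add_nonneg (Int.fract_nonneg p) (Int.fract_nonneg q), h, ⌊p⌋ + ⌊q⌋, ?_⟩
  rw [Int.cast_add, ← Int.self_sub_fract p, ← Int.self_sub_fract q]; ring

/-- `{p + q} = {p} + {q} - 1` when the sum of the fractional parts is `≥ 1`. [folklore] -/
private theorem fract_add_of_le {p q : K} (h : 1 ≤ Int.fract p + Int.fract q) :
    Int.fract (p + q) = Int.fract p + Int.fract q - 1 := by
  rw [Int.fract_eq_iff]
  refine ⟨by linarith, by linarith [Int.fract_lt_one p, Int.fract_lt_one q], ⌊p⌋ + ⌊q⌋ + 1, ?_⟩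
  rw [Int.cast_add, Int.cast_add, Int.cast_one, ← Int.self_sub_fract p, ← Int.self_sub_fract q]; ring

/-- `{p - q} = {p} - {q}` when `{q} ≤ {p}`. [folklore] -/
private theorem fract_sub_of_le {p q : K} (h : Int.fract q ≤ Int.fract p) :
    Int.fract (p - q) = Int.fract p - Int.fract q := by
  rw [Int.fract_eq_iff]
  refine ⟨sub_nonneg.2 h, by linarith [Int.fract_lt_one p, Int.fract_nonneg q], ⌊p⌋ - ⌊q⌋, ?_⟩
  rw [Int.cast_sub, ← Int.self_sub_fract p, ← Int.self_sub_fract q]; ring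

/-- `{p - q} = {p} - {q} + 1` when `{p} < {q}`. [folklore] -/
private theorem fract_sub_of_lt {p q : K} (h : Int.fract p < Int.fract q) :
    Int.fract (p - q) = Int.fract p - Int.fract q + 1 := by
  rw [Int.fract_eq_iff]
  refine ⟨by linarith [Int.fract_nonneg p, Int.fract_lt_one q], by linarith, ⌊p⌋ - ⌊q⌋ - 1, ?_⟩
  rw [Int.cast_sub, Int.cast_sub, Int.cast_one, ← Int.self_sub_fract p, ← Int.self_sub_fract q]; ring

/-- Periodicity: if `{n·a} = 0` then `{b - k·a}` only depends on `k mod n`. [folklore] -/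
private theorem fract_sub_mul_eq_fract_sub_mod_mul {a : K} {n : ℕ} (hn : Int.fract ((n : K) * a) = 0)
    (b : K) (k : ℕ) :
    Int.fract (b - k * a) = Int.fract (b - ((k % n : ℕ) : K) * a) := by
  have hna : (n : K) * a = ((⌊(n : K) * a⌋ : ℤ) : K) := by
    have h := Int.self_sub_fract ((n : K) * a)
    rwa [hn, sub_zero] at h
  have hk : ((k : ℕ) : K) = (n : K) * ((k / n : ℕ) : K) + ((k % n : ℕ) : K) := by
    exact_mod_cast (Nat.div_add_mod k n).symm
  have e : b - (k : K) * a
      = (b - ((k % n : ℕ) : K) * a) - ((((k / n : ℕ) : ℤ) * ⌊(n : K) * a⌋ : ℤ) : K) := by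
    rw [hk, Int.cast_mul, Int.cast_natCast, ← hna]; ring
  rw [e, Int.fract_sub_intCast]

end FractToolkit

/-! ### §2.2 — two-length configurations of the points `k·a mod 1`, `k < u + v` -/

/-- The configurations of [Lefevre2005, §2.2]: the `n = u + v` points `{k·a}`, `k < n`, cut `[0,1)` into
`u` intervals of length `x`, whose lower boundaries are the points of index `< u`, and `v` intervals of
length `y`, whose lower boundaries are the points of index `u, …, n - 1`; `x = {v·a}` (the left-most
interval is `[0, x)`), `1 - y = {u·a}` (the right-most is `[1-y, 1)`), `u x + v y = 1`. The interval
structure is recorded as the gap inequality `gap`: going right from the point of index `k`, every other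
point of the configuration is at distance at least the length attached to `k`.
[cite: Lefevre2005, §2.2] -/
structure IsConfig (a : K) (u v : ℕ) (x y : K) : Prop where
  u_pos : 0 < u
  v_pos : 0 < v
  x_pos : 0 < x
  y_pos : 0 < y
  fract_v : Int.fract ((v : K) * a) = x
  fract_u : Int.fract ((u : K) * a) = 1 - y
  lin : (u : K) * x + (v : K) * y = 1
  gap : ∀ ⦃k k' : ℕ⦄, k < u + v → k' < u + v → k ≠ k' →
    (if k < u then x else y) ≤ Int.fract (((k' : K) - (k : K)) * a)

namespace IsConfig

variable {a x y : K} {u v : ℕ}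

/-- `x + y ≤ 1` (from `u x + v y = 1`, `u, v ≥ 1`). [cite: Lefevre2005, §2.2] -/
theorem x_add_y_le_one (h : IsConfig a u v x y) : x + y ≤ 1 := by
  have hu : (1 : K) ≤ u := by exact_mod_cast h.u_pos
  have hv : (1 : K) ≤ v := by exact_mod_cast h.v_pos
  nlinarith [h.lin, h.x_pos, h.y_pos]

/-- `x < 1`. [cite: Lefevre2005, §2.2] -/
theorem x_lt_one (h : IsConfig a u v x y) : x < 1 := by linarith [h.x_add_y_le_one, h.y_pos]

/-- `y < 1`. [cite: Lefevre2005, §2.2] -/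
theorem y_lt_one (h : IsConfig a u v x y) : y < 1 := by linarith [h.x_add_y_le_one, h.x_pos]

/-- The gap inequality read from the other side: going right from the point of index `k`, the point of
index `k'` is at distance at most `1 - ℓ(k')`. [cite: Lefevre2005, §2.2] -/
theorem gap_le (h : IsConfig a u v x y) {k k' : ℕ} (hk : k < u + v) (hk' : k' < u + v) (hne : k ≠ k') :
    Int.fract (((k' : K) - (k : K)) * a) ≤ 1 - (if k' < u then x else y) := by
  have g := h.gap hk' hk hne.symm
  have hpos : 0 < Int.fract (((k : K) - (k' : K)) * a) := by
    refine lt_of_lt_of_le ?_ g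
    split_ifs
    · exact h.x_pos
    · exact h.y_pos
  have e : ((k' : K) - (k : K)) * a = -(((k : K) - (k' : K)) * a) := by ring
  rw [e, Int.fract_neg hpos.ne']
  linarith

/-- `{(u+v)·a} = x - y` when `y < x` (the length of the new intervals after the intervals of length `x`
split). [cite: Lefevre2005, §2.2] -/
theorem fract_n_of_lt (h : IsConfig a u v x y) (hyx : y < x) :
    Int.fract (((u + v : ℕ) : K) * a) = x - y := by
  have e : ((u + v : ℕ) : K) * a = (u : K) * a + (v : K) * a := by push_cast; ring
  have hle : 1 ≤ Int.fract ((u : K) * a) + Int.fract ((v : K) * a) := by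
    rw [h.fract_u, h.fract_v]; linarith
  rw [e, fract_add_of_le hle, h.fract_u, h.fract_v]; ring

/-- `{(u+v)·a} = x - y + 1` when `x < y`. [cite: Lefevre2005, §2.2] -/
theorem fract_n_of_gt (h : IsConfig a u v x y) (hxy : x < y) :
    Int.fract (((u + v : ℕ) : K) * a) = x - y + 1 := by
  have e : ((u + v : ℕ) : K) * a = (u : K) * a + (v : K) * a := by push_cast; ring
  have hlt : Int.fract ((u : K) * a) + Int.fract ((v : K) * a) < 1 := by
    rw [h.fract_u, h.fract_v]; linarith
  rw [e, fract_add_of_lt hlt, h.fract_u, h.fract_v]; ring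

/-- The casual equality of [Lefevre2005, §2.4]: if `x = y` then `{(u+v)·a} = 0`.
[cite: Lefevre2005, §2.4] -/
theorem fract_n_eq_zero (h : IsConfig a u v x y) (hxy : x = y) :
    Int.fract (((u + v : ℕ) : K) * a) = 0 := by
  have e : ((u + v : ℕ) : K) * a = (u : K) * a + (v : K) * a := by push_cast; ring
  have hle : 1 ≤ Int.fract ((u : K) * a) + Int.fract ((v : K) * a) := by
    rw [h.fract_u, h.fract_v]; linarith
  rw [e, fract_add_of_le hle, h.fract_u, h.fract_v, hxy]; ring

/-- The initial configuration (`n = 2`, `u = v = 1`, `x = {a}`, `y = 1 - {a}`), when `{a} ≠ 0`.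
[cite: Lefevre2005, §2.2] -/
theorem init (a : K) (ha : Int.fract a ≠ 0) : IsConfig a 1 1 (Int.fract a) (1 - Int.fract a) where
  u_pos := Nat.one_pos
  v_pos := Nat.one_pos
  x_pos := lt_of_le_of_ne (Int.fract_nonneg a) (Ne.symm ha)
  y_pos := sub_pos.2 (Int.fract_lt_one a)
  fract_v := by simp
  fract_u := by simp
  lin := by push_cast; ring
  gap := by
    intro k k' hk hk' hne
    have hk2 : k = 0 ∨ k = 1 := by omega
    have hk'2 : k' = 0 ∨ k' = 1 := by omega
    rcases hk2 with rfl | rfl <;> rcases hk'2 with rfl | rfl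
    · exact absurd rfl hne
    · simp
    · have e : (((0 : ℕ) : K) - ((1 : ℕ) : K)) * a = -a := by push_cast; ring
      rw [e, Int.fract_neg ha]; simp
    · exact absurd rfl hne

/-- **Transition `h = x`** of [Lefevre2005, §2.2]: if `y < x`, adding the points of index `n, …, n+u-1`
splits every interval of length `x` into one of length `x - y` (same lower boundary) followed by one of
length `y` (lower boundary the new point `n + j = {j·a} + (x - y)`); the new configuration is
`(u, v + u, x - y, y)`. [cite: Lefevre2005, §2.2] -/
theorem splitX (h : IsConfig a u v x y) (hyx : y < x) : IsConfig a u (v + u) (x - y) y where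
  u_pos := h.u_pos
  v_pos := Nat.add_pos_right v h.u_pos
  x_pos := sub_pos.2 hyx
  y_pos := h.y_pos
  fract_v := by rw [Nat.add_comm]; exact h.fract_n_of_lt hyx
  fract_u := h.fract_u
  lin := by push_cast; linear_combination h.lin
  gap := by
    intro k k' hk hk' hne
    have hs : Int.fract (((u + v : ℕ) : K) * a) = x - y := h.fract_n_of_lt hyx
    have hxy1 := h.x_add_y_le_one
    by_cases hkn : k < u + v <;> by_cases hk'n : k' < u + v
    · -- both points old
      have g := h.gap hkn hk'n hne
      split_ifs at g ⊢ with hku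
      · linarith [h.y_pos]
      · exact g
    · -- k old, k' = n + j new
      obtain ⟨j, rfl⟩ : ∃ j, k' = u + v + j := ⟨k' - (u + v), by omega⟩
      have hj : j < u := by omega
      have e : (((u + v + j : ℕ) : K) - (k : K)) * a
          = ((j : K) - (k : K)) * a + ((u + v : ℕ) : K) * a := by push_cast; ring
      rw [e]
      by_cases hjk : k = j
      · subst hjk
        have e0 : ((k : K) - (k : K)) * a = 0 := by ring
        rw [e0, zero_add, hs]
        simp [hj]
      · have g1 := h.gap hkn (show j < u + v by omega) hjk
        have g2 := h.gap_le hkn (show j < u + v by omega) hjk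
        simp only [hj, if_true] at g2
        have hlt : Int.fract (((j : K) - (k : K)) * a) + Int.fract (((u + v : ℕ) : K) * a) < 1 := by
          rw [hs]; linarith [h.y_pos]
        rw [fract_add_of_lt hlt, hs]
        split_ifs at g1 ⊢ with hku
        · linarith [h.x_pos]
        · linarith [h.x_pos]
    · -- k = n + j new, k' old
      obtain ⟨j, rfl⟩ : ∃ j, k = u + v + j := ⟨k - (u + v), by omega⟩
      have hj : j < u := by omega
      have hnot : ¬ (u + v + j < u) := by omega
      simp only [hnot, if_false]
      have e : ((k' : K) - ((u + v + j : ℕ) : K)) * a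
          = ((k' : K) - (j : K)) * a - ((u + v : ℕ) : K) * a := by push_cast; ring
      rw [e]
      by_cases hjk : k' = j
      · subst hjk
        have e0 : ((k' : K) - (k' : K)) * a = 0 := by ring
        have hne0 : Int.fract (((u + v : ℕ) : K) * a) ≠ 0 := by rw [hs]; exact (sub_pos.2 hyx).ne'
        rw [e0, zero_sub, Int.fract_neg hne0, hs]
        linarith [h.y_pos]
      · have g1 := h.gap (show j < u + v by omega) hk'n (Ne.symm hjk)
        simp only [hj, if_true] at g1
        have hle : Int.fract (((u + v : ℕ) : K) * a) ≤ Int.fract (((k' : K) - (j : K)) * a) := by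
          rw [hs]; linarith [h.y_pos]
        rw [fract_sub_of_le hle, hs]
        linarith
    · -- both new
      obtain ⟨j, rfl⟩ : ∃ j, k = u + v + j := ⟨k - (u + v), by omega⟩
      obtain ⟨j', rfl⟩ : ∃ j', k' = u + v + j' := ⟨k' - (u + v), by omega⟩
      have hj : j < u := by omega
      have hj' : j' < u := by omega
      have hjj : j ≠ j' := fun e => hne (by rw [e])
      have hnot : ¬ (u + v + j < u) := by omega
      simp only [hnot, if_false]
      have e : (((u + v + j' : ℕ) : K) - ((u + v + j : ℕ) : K)) * a = ((j' : K) - (j : K)) * a := by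
        push_cast; ring
      rw [e]
      have g1 := h.gap (show j < u + v by omega) (show j' < u + v by omega) hjj
      simp only [hj, if_true] at g1
      linarith

/-- **Transition `h = y`** of [Lefevre2005, §2.2]: if `x < y`, adding the points of index `n, …, n+v-1`
splits every interval of length `y` (lower boundary of index `u + j`) at the new point
`n + j = {(u+j)·a} + x` into one of length `x` followed by one of length `y - x`; the new configuration is
`(u + v, v, x, y - x)`. [cite: Lefevre2005, §2.2] -/
theorem splitY (h : IsConfig a u v x y) (hxy : x < y) : IsConfig a (u + v) v x (y - x) where
  u_pos := Nat.add_pos_left h.u_pos v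
  v_pos := h.v_pos
  x_pos := h.x_pos
  y_pos := sub_pos.2 hxy
  fract_v := h.fract_v
  fract_u := by rw [h.fract_n_of_gt hxy]; ring
  lin := by push_cast; linear_combination h.lin
  gap := by
    intro k k' hk hk' hne
    have hv : Int.fract ((v : K) * a) = x := h.fract_v
    by_cases hkn : k < u + v <;> by_cases hk'n : k' < u + v
    · -- both points old
      have g := h.gap hkn hk'n hne
      simp only [hkn, if_true]
      split_ifs at g with hku
      · exact g
      · linarith
    · -- k old, k' = n + j new
      obtain ⟨j, rfl⟩ : ∃ j, k' = u + v + j := ⟨k' - (u + v), by omega⟩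
      have hj : j < v := by omega
      simp only [hkn, if_true]
      have e : (((u + v + j : ℕ) : K) - (k : K)) * a
          = (((u + j : ℕ) : K) - (k : K)) * a + (v : K) * a := by push_cast; ring
      rw [e]
      by_cases hjk : k = u + j
      · subst hjk
        have e0 : (((u + j : ℕ) : K) - ((u + j : ℕ) : K)) * a = 0 := by ring
        rw [e0, zero_add, hv]
      · have g1 := h.gap hkn (show u + j < u + v by omega) hjk
        have g2 := h.gap_le hkn (show u + j < u + v by omega) hjk
        have hnot : ¬ (u + j < u) := by omega
        simp only [hnot, if_false] at g2
        have hlt : Int.fract ((((u + j : ℕ) : K) - (k : K)) * a) + Int.fract ((v : K) * a) < 1 := by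
          rw [hv]; linarith
        rw [fract_add_of_lt hlt, hv]
        have h0 : 0 ≤ Int.fract ((((u + j : ℕ) : K) - (k : K)) * a) := Int.fract_nonneg _
        have : (if k < u then x else y) > 0 := by split_ifs; exacts [h.x_pos, h.y_pos]
        linarith
    · -- k = n + j new, k' old
      obtain ⟨j, rfl⟩ : ∃ j, k = u + v + j := ⟨k - (u + v), by omega⟩
      have hj : j < v := by omega
      have hnot : ¬ (u + v + j < u + v) := by omega
      simp only [hnot, if_false]
      have e : ((k' : K) - ((u + v + j : ℕ) : K)) * a
          = ((k' : K) - ((u + j : ℕ) : K)) * a - (v : K) * a := by push_cast; ring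
      rw [e]
      by_cases hjk : k' = u + j
      · subst hjk
        have e0 : (((u + j : ℕ) : K) - ((u + j : ℕ) : K)) * a = 0 := by ring
        have hne0 : Int.fract ((v : K) * a) ≠ 0 := by rw [hv]; exact h.x_pos.ne'
        rw [e0, zero_sub, Int.fract_neg hne0, hv]
        linarith [h.y_lt_one]
      · have g1 := h.gap (show u + j < u + v by omega) hk'n (Ne.symm hjk)
        have hnot' : ¬ (u + j < u) := by omega
        simp only [hnot', if_false] at g1
        have hle : Int.fract ((v : K) * a) ≤ Int.fract (((k' : K) - ((u + j : ℕ) : K)) * a) := by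
          rw [hv]; linarith
        rw [fract_sub_of_le hle, hv]
        linarith
    · -- both new
      obtain ⟨j, rfl⟩ : ∃ j, k = u + v + j := ⟨k - (u + v), by omega⟩
      obtain ⟨j', rfl⟩ : ∃ j', k' = u + v + j' := ⟨k' - (u + v), by omega⟩
      have hj : j < v := by omega
      have hj' : j' < v := by omega
      have hjj : u + j ≠ u + j' := fun e => hne (by omega)
      have hnot : ¬ (u + v + j < u + v) := by omega
      simp only [hnot, if_false]
      have e : (((u + v + j' : ℕ) : K) - ((u + v + j : ℕ) : K)) * a
          = (((u + j' : ℕ) : K) - ((u + j : ℕ) : K)) * a := by push_cast; ring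
      rw [e]
      have g1 := h.gap (show u + j < u + v by omega) (show u + j' < u + v by omega) hjj
      have hnot' : ¬ (u + j < u) := by omega
      simp only [hnot', if_false] at g1
      linarith [h.x_pos]

/-! #### Where `b` sits: distances `{b - k·a}` from the points to `b` -/

/-- If `b` lies in the interval whose lower boundary is the point of index `k₀` (at distance `d` from it),
then every other point of the configuration is, going right, at distance `{(k₀ - k)·a} + d` from `b`.
[cite: Lefevre2005, §2.3] -/
theorem dist_eq (h : IsConfig a u v x y) {b d : K} {k₀ : ℕ} (hk₀ : k₀ < u + v)
    (hd : Int.fract (b - k₀ * a) = d) (hdl : d < if k₀ < u then x else y)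
    {k : ℕ} (hk : k < u + v) (hne : k ≠ k₀) :
    Int.fract (b - k * a) = Int.fract (((k₀ : K) - (k : K)) * a) + d := by
  have g2 := h.gap_le hk hk₀ hne
  have e : b - (k : K) * a = (b - (k₀ : K) * a) + ((k₀ : K) - (k : K)) * a := by ring
  have hlt : Int.fract (b - (k₀ : K) * a) + Int.fract (((k₀ : K) - (k : K)) * a) < 1 := by
    rw [hd]; linarith
  rw [e, fract_add_of_lt hlt, hd, add_comm]

/-- In particular no other point of the configuration is within `d` of `b` (to its left): its distance is
at least its own interval length plus `d`. [cite: Lefevre2005, §2.3] -/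
theorem len_add_le_dist (h : IsConfig a u v x y) {b d : K} {k₀ : ℕ} (hk₀ : k₀ < u + v)
    (hd : Int.fract (b - k₀ * a) = d) (hdl : d < if k₀ < u then x else y)
    {k : ℕ} (hk : k < u + v) (hne : k ≠ k₀) :
    (if k < u then x else y) + d ≤ Int.fract (b - k * a) := by
  rw [h.dist_eq hk₀ hd hdl hk hne]
  linarith [h.gap hk hk₀ hne]

/-- Transition `h = x`, seen from `b`: a new point `n + j` (`j < u`, `j ≠ k₀`) is at distance at least
`y + d` to the left of `b`. [cite: Lefevre2005, §2.3] -/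
theorem le_dist_splitX (h : IsConfig a u v x y) (hyx : y < x) {b d : K} {k₀ : ℕ}
    (hk₀ : k₀ < u + v) (hd : Int.fract (b - k₀ * a) = d) (hdl : d < if k₀ < u then x else y)
    {j : ℕ} (hj : j < u) (hne : j ≠ k₀) :
    y + d ≤ Int.fract (b - ((u + v + j : ℕ) : K) * a) := by
  have hs := h.fract_n_of_lt hyx
  have hd0 : 0 ≤ d := hd ▸ Int.fract_nonneg _
  have hDj := h.dist_eq hk₀ hd hdl (show j < u + v by omega) hne
  have g1 := h.gap (show j < u + v by omega) hk₀ hne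
  simp only [hj, if_true] at g1
  have e : b - ((u + v + j : ℕ) : K) * a = (b - (j : K) * a) - ((u + v : ℕ) : K) * a := by
    push_cast; ring
  have hle : Int.fract (((u + v : ℕ) : K) * a) ≤ Int.fract (b - (j : K) * a) := by
    rw [hs, hDj]; linarith [h.y_pos]
  rw [e, fract_sub_of_le hle, hs, hDj]
  linarith

/-- Transition `h = x`, seen from `b`: the new point `n + k₀` that splits `b`'s own interval is at
distance `d - (x - y)` from `b` if `b` falls in the right part, `d - (x - y) + 1` otherwise.
[cite: Lefevre2005, §2.3] -/
theorem dist_splitX_self (h : IsConfig a u v x y) (hyx : y < x) {b d : K} {k₀ : ℕ}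
    (hd : Int.fract (b - k₀ * a) = d) :
    Int.fract (b - ((u + v + k₀ : ℕ) : K) * a)
      = if x - y ≤ d then d - (x - y) else d - (x - y) + 1 := by
  have hs := h.fract_n_of_lt hyx
  have e : b - ((u + v + k₀ : ℕ) : K) * a = (b - (k₀ : K) * a) - ((u + v : ℕ) : K) * a := by
    push_cast; ring
  rw [e]
  split_ifs with hc
  · rw [fract_sub_of_le (by rw [hs, hd]; exact hc), hs, hd]
  · rw [fract_sub_of_lt (by rw [hs, hd]; exact not_le.1 hc), hs, hd]

/-- Transition `h = y`, seen from `b`: a new point `n + j` (`j < v`, `u + j ≠ k₀`) is at distance at least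
`y - x + d` to the left of `b`. [cite: Lefevre2005, §2.3] -/
theorem le_dist_splitY (h : IsConfig a u v x y) (hxy : x < y) {b d : K} {k₀ : ℕ}
    (hk₀ : k₀ < u + v) (hd : Int.fract (b - k₀ * a) = d) (hdl : d < if k₀ < u then x else y)
    {j : ℕ} (hj : j < v) (hne : u + j ≠ k₀) :
    y - x + d ≤ Int.fract (b - ((u + v + j : ℕ) : K) * a) := by
  have hv := h.fract_v
  have hd0 : 0 ≤ d := hd ▸ Int.fract_nonneg _
  have hDj := h.dist_eq hk₀ hd hdl (show u + j < u + v by omega) hne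
  have g1 := h.gap (show u + j < u + v by omega) hk₀ hne
  have hnot : ¬ (u + j < u) := by omega
  simp only [hnot, if_false] at g1
  have e : b - ((u + v + j : ℕ) : K) * a = (b - ((u + j : ℕ) : K) * a) - (v : K) * a := by
    push_cast; ring
  have hle : Int.fract ((v : K) * a) ≤ Int.fract (b - ((u + j : ℕ) : K) * a) := by
    rw [hv, hDj]; linarith
  rw [e, fract_sub_of_le hle, hv, hDj]
  linarith

/-- Transition `h = y`, seen from `b`: the new point `n + j` that splits `b`'s own interval (the one with
lower boundary `u + j`) is at distance `d - x` from `b` if `b` falls in the right part, `d - x + 1`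
otherwise. [cite: Lefevre2005, §2.3] -/
theorem dist_splitY_self (h : IsConfig a u v x y) {b d : K} {j : ℕ}
    (hd : Int.fract (b - ((u + j : ℕ) : K) * a) = d) :
    Int.fract (b - ((u + v + j : ℕ) : K) * a) = if x ≤ d then d - x else d - x + 1 := by
  have hv := h.fract_v
  have e : b - ((u + v + j : ℕ) : K) * a = (b - ((u + j : ℕ) : K) * a) - (v : K) * a := by
    push_cast; ring
  rw [e]
  split_ifs with hc
  · rw [fract_sub_of_le (by rw [hv, hd]; exact hc), hv, hd]
  · rw [fract_sub_of_lt (by rw [hv, hd]; exact not_le.1 hc), hv, hd]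

end IsConfig

/-! ### §2.3 — Algorithm 1, transcribed -/

/-- The variables of Algorithm 1 [Lefevre2005, §2.3]: the two interval lengths `x`, `y`, the distance `d`
from `b` to the lower boundary of its interval, the numbers `u`, `v` of intervals of each length, and the
subscript `r` of the interval containing `b`. [cite: Lefevre2005, §2.3] -/
structure State (K : Type*) where
  /-- length of the `u` intervals whose lower boundaries are the points of index `< u` -/
  x : K
  /-- length of the `v` intervals whose lower boundaries are the points of index `u … u+v-1` -/
  y : K
  /-- distance from `b` to the lower boundary of the interval (being) split that contains it -/
  d : K
  /-- number of intervals of length `x` -/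
  u : ℕ
  /-- number of intervals of length `y` -/
  v : ℕ
  /-- subscript of the interval containing `b` -/
  r : ℕ

/-- The first inner loop of Algorithm 1: `while (x < y) { if (u + v ≥ N) return N; y = y - x; u = u + v; }`
(`none` = "return N", `some s` = the loop exits with variables `s`). The first argument is an iteration
bound, never reached when it is `≥ N - (u + v)` (`loopY_spec`). [cite: Lefevre2005, §2.3 Algorithm 1] -/
def loopY (N : ℕ) : ℕ → State K → Option (State K)
  | 0, s => if s.x < s.y then none else some s
  | fuel + 1, s =>
    if s.x < s.y then
      if N ≤ s.u + s.v then none else loopY N fuel { s with y := s.y - s.x, u := s.u + s.v }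
    else some s

/-- The second inner loop of Algorithm 1: `while (y < x) { if (u + v ≥ N) return N; x = x - y; v = v + u; }`.
[cite: Lefevre2005, §2.3 Algorithm 1] -/
def loopX (N : ℕ) : ℕ → State K → Option (State K)
  | 0, s => if s.y < s.x then none else some s
  | fuel + 1, s =>
    if s.y < s.x then
      if N ≤ s.u + s.v then none else loopX N fuel { s with x := s.x - s.y, v := s.v + s.u }
    else some s

/-- The body of the "unconditional loop" of Algorithm 1: `Sum.inl r` = "return r", `Sum.inr s` = go round
the loop again with variables `s`. Verbatim: `if (d < x) { while…; if (u+v ≥ N) return N; x = x - y;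
if (d ≥ x) r = r + v; v = v + u } else { d = d - x; if (d < d₀) return r + u; while…;
if (u+v ≥ N) return N; y = y - x; if (d < x) r = r + u; u = u + v }`. [cite: Lefevre2005, §2.3 Algorithm 1] -/
def body (d₀ : K) (N : ℕ) (s : State K) : ℕ ⊕ State K :=
  if s.d < s.x then
    match loopY N N s with
    | none => Sum.inl N
    | some t =>
      if N ≤ t.u + t.v then Sum.inl N
      else Sum.inr { t with x := t.x - t.y, r := if t.x - t.y ≤ t.d then t.r + t.v else t.r,
                            v := t.v + t.u }
  else
    if s.d - s.x < d₀ then Sum.inl (s.r + s.u)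
    else
      match loopX N N { s with d := s.d - s.x } with
      | none => Sum.inl N
      | some t =>
        if N ≤ t.u + t.v then Sum.inl N
        else Sum.inr { t with y := t.y - t.x, r := if t.d < t.x then t.r + t.u else t.r,
                              u := t.u + t.v }

/-- The "unconditional loop" of Algorithm 1, with an iteration bound (first argument) that is never reached
when it exceeds `N - (u + v)` (`loop_spec`). [cite: Lefevre2005, §2.3 Algorithm 1] -/
def loop (d₀ : K) (N : ℕ) : ℕ → State K → ℕ
  | 0, _ => N
  | fuel + 1, s =>
    match body d₀ N s with
    | Sum.inl res => res
    | Sum.inr t => loop d₀ N fuel t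

/-- **Algorithm 1** of [Lefevre2005, §2.3]: `x = {a}; y = 1 - {a}; d = {b}; u = v = 1; r = 0;
if (d < d₀) return 0;` then the unconditional loop. [cite: Lefevre2005, §2.3 Algorithm 1] -/
def algorithm1 (a b d₀ : K) (N : ℕ) : ℕ :=
  if Int.fract b < d₀ then 0
  else loop d₀ N N ⟨Int.fract a, 1 - Int.fract a, Int.fract b, 1, 1, 0⟩

/-! ### Loop invariants and the correctness proof -/

section Spec

variable {a b d₀ : K} {N : ℕ}

/-- What a returned value `res` of Algorithm 1 guarantees (the caption of Algorithm 1): if `res < N` it is an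
index with `{b - res·a} < d₀`, and no index below `min res N` has this property.
[cite: Lefevre2005, §2.3 Algorithm 1] -/
structure Returns (a b d₀ : K) (N res : ℕ) : Prop where
  found : res < N → Int.fract (b - res * a) < d₀
  first : ∀ k : ℕ, k < N → k < res → d₀ ≤ Int.fract (b - k * a)

/-- Invariant inside the `x`-branch ("b ∈ x_r": `b` is at distance `d < x` right of the point of index
`r < u`, and every point found so far is at distance `≥ d₀`). [cite: Lefevre2005, §2.3] -/
structure XInv (a b d₀ : K) (s : State K) : Prop where
  cfg : IsConfig a s.u s.v s.x s.y
  d₀_le : d₀ ≤ s.d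
  d_lt : s.d < s.x
  r_lt : s.r < s.u
  dist_r : Int.fract (b - s.r * a) = s.d
  checked : ∀ k : ℕ, k < s.u + s.v → d₀ ≤ Int.fract (b - k * a)

/-- Invariant inside the `else`-branch after its `d₀`-test ("b ∈ y_r": `b` is at distance `d < y` right of
the point of index `u + r`, `r < v`; every point found so far is at distance `≥ d₀`).
[cite: Lefevre2005, §2.3] -/
structure YInv (a b d₀ : K) (s : State K) : Prop where
  cfg : IsConfig a s.u s.v s.x s.y
  d₀_le : d₀ ≤ s.d
  d_lt : s.d < s.y
  r_lt : s.r < s.v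
  dist_r : Int.fract (b - ((s.u + s.r : ℕ) : K) * a) = s.d
  checked : ∀ k : ℕ, k < s.u + s.v → d₀ ≤ Int.fract (b - k * a)

/-- Invariant at the head of the unconditional loop: an interval has just been split into a part of length
`x` (lower boundary of index `r` if `d < x`) followed by a part of length `y` (lower boundary the NEW point
of index `u + r` if `d ≥ x`, not yet tested against `d₀`); `d` is the distance from the lower boundary of the
`x`-part. [cite: Lefevre2005, §2.3] -/
structure HeadInv (a b d₀ : K) (s : State K) : Prop where
  cfg : IsConfig a s.u s.v s.x s.y
  d₀_le : d₀ ≤ s.d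
  inX : s.d < s.x →
    s.r < s.u ∧ Int.fract (b - s.r * a) = s.d ∧ ∀ k : ℕ, k < s.u + s.v → d₀ ≤ Int.fract (b - k * a)
  inY : s.x ≤ s.d →
    s.d < s.x + s.y ∧ s.r < s.v ∧ Int.fract (b - ((s.u + s.r : ℕ) : K) * a) = s.d - s.x ∧
      ∀ k : ℕ, k < s.u + s.v → k ≠ s.u + s.r → d₀ ≤ Int.fract (b - k * a)

/-- The degenerate states of [Lefevre2005, §2.4] (a casual equality `{(u+v)·a} = 0` made a length vanish):
from then on the points repeat, every point is already known to be at distance `≥ d₀`, and the algorithm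
runs until `u + v ≥ N`. [cite: Lefevre2005, §2.4] -/
structure Degenerate (a b d₀ : K) (s : State K) : Prop where
  all_checked : ∀ k : ℕ, d₀ ≤ Int.fract (b - k * a)
  d₀_le : d₀ ≤ s.d
  d_nonneg : 0 ≤ s.d
  u_pos : 0 < s.u
  v_pos : 0 < s.v
  shape : (s.x = 0 ∧ 0 ≤ s.y) ∨ (s.y = 0 ∧ s.d < s.x)

/-! #### The inner loops -/

/-- One iteration of the first inner loop preserves `XInv`. [cite: Lefevre2005, §2.2–2.3] -/
theorem XInv.stepY {s : State K} (hs : XInv a b d₀ s) (hxy : s.x < s.y) :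
    XInv a b d₀ { s with y := s.y - s.x, u := s.u + s.v } where
  cfg := hs.cfg.splitY hxy
  d₀_le := hs.d₀_le
  d_lt := hs.d_lt
  r_lt := by have := hs.r_lt; dsimp only; omega
  dist_r := hs.dist_r
  checked := by
    intro k hk
    dsimp only at hk
    by_cases hkn : k < s.u + s.v
    · exact hs.checked k hkn
    · obtain ⟨j, rfl⟩ : ∃ j, k = s.u + s.v + j := ⟨k - (s.u + s.v), by omega⟩
      have hj : j < s.v := by omega
      have hr := hs.r_lt
      have hdl : s.d < if s.r < s.u then s.x else s.y := by rw [if_pos hr]; exact hs.d_lt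
      have := hs.cfg.le_dist_splitY hxy (by omega) hs.dist_r hdl hj (by omega)
      linarith [hs.d₀_le, hs.cfg.x_pos]

/-- One iteration of the second inner loop preserves `YInv`. [cite: Lefevre2005, §2.2–2.3] -/
theorem YInv.stepX {s : State K} (hs : YInv a b d₀ s) (hyx : s.y < s.x) :
    YInv a b d₀ { s with x := s.x - s.y, v := s.v + s.u } where
  cfg := hs.cfg.splitX hyx
  d₀_le := hs.d₀_le
  d_lt := hs.d_lt
  r_lt := by have := hs.r_lt; dsimp only; omega
  dist_r := hs.dist_r
  checked := by
    intro k hk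
    dsimp only at hk
    by_cases hkn : k < s.u + s.v
    · exact hs.checked k hkn
    · obtain ⟨j, rfl⟩ : ∃ j, k = s.u + s.v + j := ⟨k - (s.u + s.v), by omega⟩
      have hj : j < s.u := by omega
      have hr := hs.r_lt
      have hdl : s.d < if s.u + s.r < s.u then s.x else s.y := by
        rw [if_neg (by omega)]; exact hs.d_lt
      have := hs.cfg.le_dist_splitX hyx (by omega) hs.dist_r hdl hj (by omega)
      linarith [hs.d₀_le, hs.cfg.y_pos]

/-- The first inner loop: it returns `N` only when every `k < N` is known to be at distance `≥ d₀`, and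
otherwise exits with `y ≤ x`, `XInv` preserved, `d` unchanged and `u + v` not decreased — provided the
iteration bound is at least `N - (u + v)`. [cite: Lefevre2005, §2.3] -/
theorem loopY_spec (N : ℕ) : ∀ (fuel : ℕ) (s : State K), XInv a b d₀ s → N - (s.u + s.v) ≤ fuel →
    (loopY N fuel s = none → ∀ k : ℕ, k < N → d₀ ≤ Int.fract (b - k * a)) ∧
    (∀ t, loopY N fuel s = some t → XInv a b d₀ t ∧ t.y ≤ t.x ∧ t.d = s.d ∧ s.u + s.v ≤ t.u + t.v)
  | 0, s, hs, hf => by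
    simp only [loopY]
    split_ifs with hxy
    · exact ⟨fun _ k hk => hs.checked k (by omega), fun t ht => by cases ht⟩
    · exact ⟨fun h => h.elim, fun t ht => by cases ht; exact ⟨hs, not_lt.1 hxy, rfl, le_rfl⟩⟩
  | fuel + 1, s, hs, hf => by
    simp only [loopY]
    split_ifs with hxy hN
    · exact ⟨fun _ k hk => hs.checked k (by omega), fun t ht => by cases ht⟩
    · have hv := hs.cfg.v_pos
      obtain ⟨h1, h2⟩ := loopY_spec N fuel _ (hs.stepY hxy) (by dsimp only; omega)
      refine ⟨h1, fun t ht => ?_⟩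
      obtain ⟨ht1, ht2, ht3, ht4⟩ := h2 t ht
      dsimp only at ht3 ht4
      exact ⟨ht1, ht2, ht3, by omega⟩
    · exact ⟨fun h => h.elim, fun t ht => by cases ht; exact ⟨hs, not_lt.1 hxy, rfl, le_rfl⟩⟩

/-- The second inner loop, symmetrically. [cite: Lefevre2005, §2.3] -/
theorem loopX_spec (N : ℕ) : ∀ (fuel : ℕ) (s : State K), YInv a b d₀ s → N - (s.u + s.v) ≤ fuel →
    (loopX N fuel s = none → ∀ k : ℕ, k < N → d₀ ≤ Int.fract (b - k * a)) ∧
    (∀ t, loopX N fuel s = some t → YInv a b d₀ t ∧ t.x ≤ t.y ∧ t.d = s.d ∧ s.u + s.v ≤ t.u + t.v)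
  | 0, s, hs, hf => by
    simp only [loopX]
    split_ifs with hyx
    · exact ⟨fun _ k hk => hs.checked k (by omega), fun t ht => by cases ht⟩
    · exact ⟨fun h => h.elim, fun t ht => by cases ht; exact ⟨hs, not_lt.1 hyx, rfl, le_rfl⟩⟩
  | fuel + 1, s, hs, hf => by
    simp only [loopX]
    split_ifs with hyx hN
    · exact ⟨fun _ k hk => hs.checked k (by omega), fun t ht => by cases ht⟩
    · have hu := hs.cfg.u_pos
      obtain ⟨h1, h2⟩ := loopX_spec N fuel _ (hs.stepX hyx) (by dsimp only; omega)
      refine ⟨h1, fun t ht => ?_⟩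
      obtain ⟨ht1, ht2, ht3, ht4⟩ := h2 t ht
      dsimp only at ht3 ht4
      exact ⟨ht1, ht2, ht3, by omega⟩
    · exact ⟨fun h => h.elim, fun t ht => by cases ht; exact ⟨hs, not_lt.1 hyx, rfl, le_rfl⟩⟩

omit [IsStrictOrderedRing K] [FloorRing K] in
/-- When its guard is false from the start, the first inner loop exits at once. [cite: Lefevre2005, §2.3] -/
theorem loopY_of_not_lt (N fuel : ℕ) {s : State K} (h : ¬ s.x < s.y) : loopY N fuel s = some s := by
  cases fuel <;> simp [loopY, h]

omit [IsStrictOrderedRing K] [FloorRing K] in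
/-- When its guard is false from the start, the second inner loop exits at once. [cite: Lefevre2005, §2.3] -/
theorem loopX_of_not_lt (N fuel : ℕ) {s : State K} (h : ¬ s.y < s.x) : loopX N fuel s = some s := by
  cases fuel <;> simp [loopX, h]

/-! #### The splits that concern `b` (end of each branch) -/

/-- End of the `x`-branch, generic case `y < x`: the next loop head satisfies `HeadInv`.
[cite: Lefevre2005, §2.3] -/
theorem XInv.split {t : State K} (ht : XInv a b d₀ t) (hyx : t.y < t.x) :
    HeadInv a b d₀ { t with x := t.x - t.y, r := if t.x - t.y ≤ t.d then t.r + t.v else t.r,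
                            v := t.v + t.u } := by
  have hcfg := ht.cfg.splitX hyx
  have hr := ht.r_lt
  have hdl : t.d < if t.r < t.u then t.x else t.y := by rw [if_pos hr]; exact ht.d_lt
  have hn : t.r < t.u + t.v := by omega
  have hself := ht.cfg.dist_splitX_self hyx ht.dist_r
  have hx1 := hcfg.x_lt_one
  refine ⟨hcfg, ht.d₀_le, fun h1 => ?_, fun h2 => ?_⟩
  · -- b stays in the part of length x - y
    dsimp only at h1 ⊢
    have hc : ¬ t.x - t.y ≤ t.d := not_le.2 h1
    rw [if_neg hc]
    refine ⟨hr, ht.dist_r, fun k hk => ?_⟩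
    by_cases hkn : k < t.u + t.v
    · exact ht.checked k hkn
    · obtain ⟨j, rfl⟩ : ∃ j, k = t.u + t.v + j := ⟨k - (t.u + t.v), by omega⟩
      have hj : j < t.u := by omega
      by_cases hjr : j = t.r
      · subst hjr; rw [hself, if_neg hc]; linarith [ht.d₀_le]
      · have := ht.cfg.le_dist_splitX hyx hn ht.dist_r hdl hj hjr
        linarith [ht.d₀_le, ht.cfg.y_pos]
  · -- b goes to the new part of length y: its lower boundary is the new point (u + v) + r
    dsimp only at h2 ⊢
    rw [if_pos h2]
    refine ⟨by linarith [ht.d_lt], by omega, ?_, fun k hk hkne => ?_⟩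
    · have ei : t.u + (t.r + t.v) = t.u + t.v + t.r := by omega
      rw [ei, hself, if_pos h2]
    · by_cases hkn : k < t.u + t.v
      · exact ht.checked k hkn
      · obtain ⟨j, rfl⟩ : ∃ j, k = t.u + t.v + j := ⟨k - (t.u + t.v), by omega⟩
        have hj : j < t.u := by omega
        have hjr : j ≠ t.r := fun e => hkne (by omega)
        have := ht.cfg.le_dist_splitX hyx hn ht.dist_r hdl hj hjr
        linarith [ht.d₀_le, ht.cfg.y_pos]

/-- End of the `x`-branch, casual equality `y = x` (§2.4): the new length `x - y` vanishes, the points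
repeat with period `u + v`, and all of them are already known to be at distance `≥ d₀`.
[cite: Lefevre2005, §2.4] -/
theorem XInv.split_degenerate {t : State K} (ht : XInv a b d₀ t) (hxy : t.y = t.x) :
    Degenerate a b d₀ { t with x := t.x - t.y, r := if t.x - t.y ≤ t.d then t.r + t.v else t.r,
                               v := t.v + t.u } := by
  have hn0 := ht.cfg.fract_n_eq_zero hxy.symm
  have hnpos : 0 < t.u + t.v := Nat.add_pos_left ht.cfg.u_pos _
  have hd0 : 0 ≤ t.d := ht.dist_r ▸ Int.fract_nonneg _
  refine ⟨fun k => ?_, ht.d₀_le, hd0, ht.cfg.u_pos, Nat.add_pos_left ht.cfg.v_pos _, ?_⟩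
  · rw [fract_sub_mul_eq_fract_sub_mod_mul hn0]
    exact ht.checked _ (Nat.mod_lt _ hnpos)
  · left; dsimp only; exact ⟨by rw [hxy, sub_self], ht.cfg.y_pos.le⟩

/-- End of the `else`-branch, generic case `x < y`: the next loop head satisfies `HeadInv`.
[cite: Lefevre2005, §2.3] -/
theorem YInv.split {t : State K} (ht : YInv a b d₀ t) (hxy : t.x < t.y) :
    HeadInv a b d₀ { t with y := t.y - t.x, r := if t.d < t.x then t.r + t.u else t.r,
                            u := t.u + t.v } := by
  have hcfg := ht.cfg.splitY hxy
  have hr := ht.r_lt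
  have hdl : t.d < if t.u + t.r < t.u then t.x else t.y := by rw [if_neg (by omega)]; exact ht.d_lt
  have hn : t.u + t.r < t.u + t.v := by omega
  have hself := ht.cfg.dist_splitY_self (j := t.r) ht.dist_r
  have hx1 := ht.cfg.x_lt_one
  refine ⟨hcfg, ht.d₀_le, fun h1 => ?_, fun h2 => ?_⟩
  · -- b is in the part of length x: lower boundary u + r, which becomes the subscript r + u
    dsimp only at h1 ⊢
    rw [if_pos h1]
    refine ⟨by omega, ?_, fun k hk => ?_⟩
    · have ei : ((t.r + t.u : ℕ) : K) = ((t.u + t.r : ℕ) : K) := by rw [Nat.add_comm]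
      rw [ei]; exact ht.dist_r
    · by_cases hkn : k < t.u + t.v
      · exact ht.checked k hkn
      · obtain ⟨j, rfl⟩ : ∃ j, k = t.u + t.v + j := ⟨k - (t.u + t.v), by omega⟩
        have hj : j < t.v := by omega
        by_cases hjr : j = t.r
        · subst hjr; rw [hself, if_neg (not_le.2 h1)]; linarith [ht.d₀_le]
        · have := ht.cfg.le_dist_splitY hxy hn ht.dist_r hdl hj (fun e => hjr (by omega))
          linarith [ht.d₀_le]
  · -- b goes to the part of length y - x: lower boundary the new point (u + v) + r
    dsimp only at h2 ⊢
    rw [if_neg (not_lt.2 h2)]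
    refine ⟨by linarith [ht.d_lt], hr, ?_, fun k hk hkne => ?_⟩
    · rw [hself, if_pos h2]
    · by_cases hkn : k < t.u + t.v
      · exact ht.checked k hkn
      · obtain ⟨j, rfl⟩ : ∃ j, k = t.u + t.v + j := ⟨k - (t.u + t.v), by omega⟩
        have hj : j < t.v := by omega
        have hjr : j ≠ t.r := fun e => hkne (by omega)
        have := ht.cfg.le_dist_splitY hxy hn ht.dist_r hdl hj (fun e => hjr (by omega))
        linarith [ht.d₀_le]

/-- End of the `else`-branch, casual equality `x = y` (§2.4). [cite: Lefevre2005, §2.4] -/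
theorem YInv.split_degenerate {t : State K} (ht : YInv a b d₀ t) (hxy : t.x = t.y) :
    Degenerate a b d₀ { t with y := t.y - t.x, r := if t.d < t.x then t.r + t.u else t.r,
                               u := t.u + t.v } := by
  have hn0 := ht.cfg.fract_n_eq_zero hxy
  have hnpos : 0 < t.u + t.v := Nat.add_pos_left ht.cfg.u_pos _
  have hd0 : 0 ≤ t.d := ht.dist_r ▸ Int.fract_nonneg _
  refine ⟨fun k => ?_, ht.d₀_le, hd0, Nat.add_pos_left ht.cfg.u_pos _, ht.cfg.v_pos, ?_⟩
  · rw [fract_sub_mul_eq_fract_sub_mod_mul hn0]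
    exact ht.checked _ (Nat.mod_lt _ hnpos)
  · right; dsimp only; exact ⟨by rw [hxy, sub_self], by rw [hxy]; exact ht.d_lt⟩

/-! #### One round of the unconditional loop -/

/-- One round of the loop from a `HeadInv` state: a returned value satisfies `Returns`; otherwise the next
head state satisfies `HeadInv` or is `Degenerate`, and `u + v` has increased from a value `< N`.
[cite: Lefevre2005, §2.3] -/
theorem body_spec_head {s : State K} (hs : HeadInv a b d₀ s) :
    (∀ res, body d₀ N s = Sum.inl res → Returns a b d₀ N res) ∧
    (∀ t, body d₀ N s = Sum.inr t →
      (HeadInv a b d₀ t ∨ Degenerate a b d₀ t) ∧ s.u + s.v < N ∧ s.u + s.v < t.u + t.v) := by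
  by_cases hdx : s.d < s.x
  · -- the x-branch
    obtain ⟨hr, hdist, hchk⟩ := hs.inX hdx
    have hX : XInv a b d₀ s := ⟨hs.cfg, hs.d₀_le, hdx, hr, hdist, hchk⟩
    obtain ⟨hnone, hsome⟩ := loopY_spec (a := a) (b := b) (d₀ := d₀) N N s hX (by omega)
    cases hl : loopY N N s with
    | none =>
      simp only [body, hdx, if_true, hl]
      refine ⟨fun res hres => ?_, fun t ht => by cases ht⟩
      cases hres
      exact ⟨fun h => absurd h (lt_irrefl _), fun k hk _ => hnone hl k hk⟩
    | some t =>
      obtain ⟨ht, hyx, -, hsum⟩ := hsome t hl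
      simp only [body, hdx, if_true, hl]
      by_cases hN : N ≤ t.u + t.v
      · simp only [hN, if_true]
        refine ⟨fun res hres => ?_, fun t ht => by cases ht⟩
        cases hres
        exact ⟨fun h => absurd h (lt_irrefl _), fun k hk _ => ht.checked k (by omega)⟩
      · simp only [hN, if_false]
        refine ⟨fun res hres => (by cases hres), fun t' ht' => ?_⟩
        cases ht'
        refine ⟨?_, by omega, by have := ht.cfg.u_pos; dsimp only; omega⟩
        rcases lt_or_eq_of_le hyx with hlt | heq
        · exact Or.inl (ht.split hlt)
        · exact Or.inr (ht.split_degenerate heq)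
  · -- the else-branch
    have hxd : s.x ≤ s.d := not_lt.1 hdx
    obtain ⟨hdxy, hr, hdist, hchk⟩ := hs.inY hxd
    by_cases hfound : s.d - s.x < d₀
    · simp only [body, hdx, if_false, hfound, if_true]
      refine ⟨fun res hres => ?_, fun t ht => by cases ht⟩
      cases hres
      refine ⟨fun _ => ?_, fun k hk hkr => hchk k (by omega) (by omega)⟩
      have ei : ((s.r + s.u : ℕ) : K) = ((s.u + s.r : ℕ) : K) := by rw [Nat.add_comm]
      rw [ei, hdist]; exact hfound
    · have hY : YInv a b d₀ { s with d := s.d - s.x } := by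
        refine ⟨hs.cfg, not_lt.1 hfound, by dsimp only; linarith, hr, hdist, fun k hk => ?_⟩
        dsimp only at hk
        by_cases hkr : k = s.u + s.r
        · rw [hkr, hdist]; exact not_lt.1 hfound
        · exact hchk k hk hkr
      obtain ⟨hnone, hsome⟩ := loopX_spec (a := a) (b := b) (d₀ := d₀) N N _ hY (by dsimp only; omega)
      cases hl : loopX N N { s with d := s.d - s.x } with
      | none =>
        simp only [body, hdx, if_false, hfound, hl]
        refine ⟨fun res hres => ?_, fun t ht => by cases ht⟩
        cases hres
        exact ⟨fun h => absurd h (lt_irrefl _), fun k hk _ => hnone hl k hk⟩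
      | some t =>
        obtain ⟨ht, hxy, -, hsum⟩ := hsome t hl
        dsimp only at hsum
        simp only [body, hdx, if_false, hfound, hl]
        by_cases hN : N ≤ t.u + t.v
        · simp only [hN, if_true]
          refine ⟨fun res hres => ?_, fun t ht => by cases ht⟩
          cases hres
          exact ⟨fun h => absurd h (lt_irrefl _), fun k hk _ => ht.checked k (by omega)⟩
        · simp only [hN, if_false]
          refine ⟨fun res hres => (by cases hres), fun t' ht' => ?_⟩
          cases ht'
          refine ⟨?_, by omega, by have := ht.cfg.v_pos; dsimp only; omega⟩
          rcases lt_or_eq_of_le hxy with hlt | heq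
          · exact Or.inl (ht.split hlt)
          · exact Or.inr (ht.split_degenerate heq)

omit [IsStrictOrderedRing K] in
/-- One round of the loop from a `Degenerate` state (§2.4): it returns `N` or stays degenerate with
`u + v` increased. [cite: Lefevre2005, §2.4] -/
theorem body_spec_degenerate {s : State K} (hs : Degenerate a b d₀ s) :
    (∀ res, body d₀ N s = Sum.inl res → Returns a b d₀ N res) ∧
    (∀ t, body d₀ N s = Sum.inr t →
      (HeadInv a b d₀ t ∨ Degenerate a b d₀ t) ∧ s.u + s.v < N ∧ s.u + s.v < t.u + t.v) := by
  have hret : Returns a b d₀ N N :=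
    ⟨fun h => absurd h (lt_irrefl _), fun k _ _ => hs.all_checked k⟩
  rcases hs.shape with ⟨hx, hy⟩ | ⟨hy, hdx⟩
  · -- x = 0: the else-branch, whose d₀-test fails and whose inner loop does nothing
    have hndx : ¬ s.d < s.x := by rw [hx]; exact not_lt.2 hs.d_nonneg
    have hnf : ¬ s.d - s.x < d₀ := by rw [hx, sub_zero]; exact not_lt.2 hs.d₀_le
    have hl : loopX N N { s with d := s.d - s.x } = some { s with d := s.d - s.x } :=
      loopX_of_not_lt N N (by dsimp only; rw [hx]; exact not_lt.2 hy)
    simp only [body, hndx, if_false, hnf, hl]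
    by_cases hN : N ≤ s.u + s.v
    · simp only [hN, if_true]
      exact ⟨fun res hres => by cases hres; exact hret, fun t ht => by cases ht⟩
    · simp only [hN, if_false]
      refine ⟨fun res hres => (by cases hres), fun t ht => ?_⟩
      cases ht
      refine ⟨Or.inr ⟨hs.all_checked, ?_, ?_, ?_, hs.v_pos, Or.inl ⟨hx, ?_⟩⟩, by omega,
        by have := hs.v_pos; dsimp only; omega⟩
      · dsimp only; rw [hx, sub_zero]; exact hs.d₀_le
      · dsimp only; rw [hx, sub_zero]; exact hs.d_nonneg
      · exact Nat.add_pos_left hs.u_pos _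
      · dsimp only; rw [hx, sub_zero]; exact hy
  · -- y = 0: the x-branch, whose inner loop does nothing
    have hxpos : 0 < s.x := lt_of_le_of_lt hs.d_nonneg hdx
    have hl : loopY N N s = some s := loopY_of_not_lt N N (by rw [hy]; exact not_lt.2 hxpos.le)
    simp only [body, hdx, if_true, hl]
    by_cases hN : N ≤ s.u + s.v
    · simp only [hN, if_true]
      exact ⟨fun res hres => by cases hres; exact hret, fun t ht => by cases ht⟩
    · simp only [hN, if_false]
      refine ⟨fun res hres => (by cases hres), fun t ht => ?_⟩
      cases ht
      refine ⟨Or.inr ⟨hs.all_checked, hs.d₀_le, hs.d_nonneg, hs.u_pos, ?_, Or.inr ⟨hy, ?_⟩⟩,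
        by omega, by have := hs.u_pos; dsimp only; omega⟩
      · exact Nat.add_pos_left hs.v_pos _
      · dsimp only; rw [hy, sub_zero]; exact hdx

/-- **The unconditional loop is correct** from any `HeadInv` or `Degenerate` state, given an iteration
bound `> N - (u + v)`. [cite: Lefevre2005, §2.3] -/
theorem loop_spec : ∀ (fuel : ℕ) (s : State K), (HeadInv a b d₀ s ∨ Degenerate a b d₀ s) →
    N - (s.u + s.v) < fuel → Returns a b d₀ N (loop d₀ N fuel s)
  | 0, _, _, hf => absurd hf (Nat.not_lt_zero _)
  | fuel + 1, s, hs, hf => by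
    have hb := hs.elim (fun h => body_spec_head (N := N) h) (fun h => body_spec_degenerate (N := N) h)
    simp only [loop]
    cases hbody : body d₀ N s with
    | inl res => simpa using hb.1 res hbody
    | inr t =>
      obtain ⟨ht, h1, h2⟩ := hb.2 t hbody
      exact loop_spec fuel t ht (by omega)

/-- The initial state is a loop-head state when `{a} ≠ 0`. [cite: Lefevre2005, §2.3] -/
theorem headInv_init (hb : d₀ ≤ Int.fract b) (ha : Int.fract a ≠ 0) :
    HeadInv a b d₀ ⟨Int.fract a, 1 - Int.fract a, Int.fract b, 1, 1, 0⟩ := by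
  have hcfg := IsConfig.init a ha
  have e1 : b - ((1 : ℕ) : K) * a = b - a := by push_cast; ring
  refine ⟨hcfg, hb, fun h1 => ⟨Nat.one_pos, by simp, fun k hk => ?_⟩, fun h2 => ⟨by linarith [Int.fract_lt_one b], Nat.one_pos, ?_, fun k hk hk1 => ?_⟩⟩
  · -- k = 0 or k = 1; the point {a} lies to the right of b
    have hk2 : k = 0 ∨ k = 1 := by simp at hk; omega
    rcases hk2 with rfl | rfl
    · simpa using hb
    · rw [e1, fract_sub_of_lt h1]; linarith [Int.fract_lt_one a]
  · show Int.fract (b - ((1 + 0 : ℕ) : K) * a) = Int.fract b - Int.fract a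
    rw [Nat.add_zero, e1, fract_sub_of_le h2]
  · have hk0 : k = 0 := by simp at hk hk1; omega
    subst hk0; simpa using hb

/-- The initial state is degenerate when `{a} = 0` (then every point is `0`). [cite: Lefevre2005, §2.4] -/
theorem degenerate_init (hb : d₀ ≤ Int.fract b) (ha : Int.fract a = 0) :
    Degenerate a b d₀ ⟨Int.fract a, 1 - Int.fract a, Int.fract b, 1, 1, 0⟩ := by
  have h1 : Int.fract (((1 : ℕ) : K) * a) = 0 := by simpa using ha
  refine ⟨fun k => ?_, hb, Int.fract_nonneg b, Nat.one_pos, Nat.one_pos, Or.inl ⟨ha, ?_⟩⟩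
  · rw [fract_sub_mul_eq_fract_sub_mod_mul h1, Nat.mod_one]; simpa using hb
  · show 0 ≤ 1 - Int.fract a
    linarith [Int.fract_lt_one a]

/-- **Theorem (Lefèvre 2005, Algorithm 1 is correct; no side condition).** Let
`r = algorithm1 a b d₀ N`. If `r < N` then `{b - r·a} < d₀`; and `{b - k·a} ≥ d₀` for every `k < N` with
`k < r`. That is: the algorithm returns the first `r ∈ ⟦0, N-1⟧` with `{b - r·a} < d₀` if there is one, and
an integer `≥ N` otherwise. [cite: Lefevre2005, §2.3 Algorithm 1] -/
theorem algorithm1_spec (a b d₀ : K) (N : ℕ) :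
    (algorithm1 a b d₀ N < N → Int.fract (b - (algorithm1 a b d₀ N) * a) < d₀) ∧
    ∀ k : ℕ, k < N → k < algorithm1 a b d₀ N → d₀ ≤ Int.fract (b - k * a) := by
  have key : Returns a b d₀ N (algorithm1 a b d₀ N) := by
    unfold algorithm1
    split_ifs with hb
    · exact ⟨fun _ => by simpa using hb, fun k _ hk => absurd hk (Nat.not_lt_zero _)⟩
    · have hb' : d₀ ≤ Int.fract b := not_lt.1 hb
      rcases Nat.eq_zero_or_pos N with rfl | hN
      · exact ⟨fun h => absurd h (Nat.not_lt_zero _), fun k hk => absurd hk (Nat.not_lt_zero _)⟩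
      · refine loop_spec N _ ?_ (by show N - (1 + 1) < N; omega)
        by_cases ha : Int.fract a = 0
        · exact Or.inr (degenerate_init hb' ha)
        · exact Or.inl (headInv_init hb' ha)
  exact ⟨key.found, key.first⟩

/-- The test that the worst-case searches run on every sub-domain ([Lefevre1999]; [Lefevre2005, §4] variant
"−"): `algorithm1` returns a value `≥ N` iff NO `k < N` has `{b - k·a} < d₀` — a decidable criterion for a
universally quantified statement. [cite: Lefevre2005, §2.3 Algorithm 1] -/
theorem le_algorithm1_iff (a b d₀ : K) (N : ℕ) :
    N ≤ algorithm1 a b d₀ N ↔ ∀ k : ℕ, k < N → d₀ ≤ Int.fract (b - k * a) := by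
  obtain ⟨h1, h2⟩ := algorithm1_spec a b d₀ N
  constructor
  · exact fun h k hk => h2 k hk (lt_of_lt_of_le hk h)
  · intro h
    by_contra hlt
    exact absurd (h _ (not_le.1 hlt)) (not_le.2 (h1 (not_le.1 hlt)))

/-- If the returned value is `< N` it is the FIRST index at distance `< d₀`. [cite: Lefevre2005, §2.3] -/
theorem algorithm1_lt_imp (a b d₀ : K) (N : ℕ) (h : algorithm1 a b d₀ N < N) :
    Int.fract (b - (algorithm1 a b d₀ N) * a) < d₀ ∧
      ∀ k : ℕ, k < algorithm1 a b d₀ N → d₀ ≤ Int.fract (b - k * a) :=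
  ⟨(algorithm1_spec a b d₀ N).1 h, fun k hk => (algorithm1_spec a b d₀ N).2 k (lt_trans hk h) hk⟩

end Spec

/-- Worked instance (the algorithm computes in `ℚ`; the kernel evaluates it): among the 300 points
`{1/3 - k·(355/1137)}`, `k < 300`, none is below `1/5000` — certified by running Algorithm 1 (which here
returns `379 ≥ 300`: the first point below `1/5000` has index 379), not by enumerating `k`.
[cite: Lefevre2005, §2.3 Algorithm 1] -/
example : ∀ k : ℕ, k < 300 → (1 / 5000 : ℚ) ≤ Int.fract ((1 / 3 : ℚ) - k * (355 / 1137)) :=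
  (le_algorithm1_iff (355 / 1137 : ℚ) (1 / 3) (1 / 5000) 300).1 (by decide +kernel)

/-- … and with `N = 1000` the algorithm finds that first index, `379`. [cite: Lefevre2005, §2.3 Algorithm 1] -/
example : algorithm1 (355 / 1137 : ℚ) (1 / 3) (1 / 5000) 1000 = 379 := by decide +kernel

/-- A sub-domain of the size used in the binary64 searches: `2^16` arguments, 64-bit slope and intercept,
threshold `2^-30`; no point of the grid is that close to the segment. [cite: Lefevre2005, §2.3 Algorithm 1] -/
example : ∀ k : ℕ, k < 2 ^ 16 →
    (1 / 2 ^ 30 : ℚ) ≤ Int.fract ((0x243F6A8885A308D3 / 2 ^ 64 : ℚ) - k * (0x9E3779B97F4A7C15 / 2 ^ 64)) :=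
  (le_algorithm1_iff (0x9E3779B97F4A7C15 / 2 ^ 64 : ℚ) (0x243F6A8885A308D3 / 2 ^ 64) (1 / 2 ^ 30)
    (2 ^ 16)).1 (by decide +kernel)

/-! ### Using Algorithm 1 on a sub-domain of a function (§1, §2.3), and evaluating it over `ℚ`

"The domain on which the function is to be tested is split into small subdomains where the function can be
approximated by a degree-1 polynomial, i.e., the graph of the function is approximated by segments. Then the
algorithm … can be used on each subdomain to find the points of the regular grid … that are the closest to
the segment" [Lefevre2005, §1]; "In the case the segment approximates a curve, one can also add some
correction terms to a and/or b to take into account a part of the approximation error" [Lefevre2005, §2.3].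
Below: the window form (intercept `b + w`, threshold `2w` catches every point within `w` of the segment on
EITHER side), the resulting statement "no value of the sub-domain is within `η` of an integer" (with
`η = 2^(-μ)` this is literally `¬ IsBadCaseDir μ` of
`Literature.ComputerArithmetic.BrisebarreHanrotMullerZimmermann2025`, kept import-free here), and the fact
that running Algorithm 1 on rational data inside any ordered field gives the same answer as running it in
`ℚ` (so a `decide` over `ℚ` certifies a statement about real values). -/

section SubDomain

/-- The two-sided window: if `2w ≤ {s + w}` then `s` is at distance at least `w` from every integer.
[cite: Lefevre2005, §2.3] -/
theorem le_abs_sub_int_of_le_fract {s w : K} (h : 2 * w ≤ Int.fract (s + w)) (m : ℤ) : w ≤ |s - m| := by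
  by_contra hlt
  push Not at hlt
  obtain ⟨h1, h2⟩ := abs_lt.1 hlt
  rcases le_or_gt (2 * w) 1 with hw1 | hw1
  · have hfr : Int.fract (s + w) = s + w - m := by
      rw [Int.fract_eq_iff]
      exact ⟨by linarith, by linarith, m, by ring⟩
    rw [hfr] at h
    linarith
  · linarith [Int.fract_lt_one (s + w)]

/-- **Lefèvre's use of Algorithm 1 on a sub-domain** [Lefevre2005, §1, §2.3]: the values `g k`, `k < N`
(the scaled function on the sub-domain) are within `δ` of the segment `b − k·a`; if Algorithm 1 run with
intercept `b + w` and threshold `2w`, where `η + δ ≤ w`, returns a value `≥ N` — no point of the grid is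
within `w` of the segment — then no `g k` is within `η` of an integer. [cite: Lefevre2005, §2.3] -/
theorem le_abs_sub_int_of_algorithm1 {a b δ w η : K} {N : ℕ} {g : ℕ → K}
    (happrox : ∀ k : ℕ, k < N → |g k - (b - k * a)| ≤ δ) (hw : η + δ ≤ w)
    (halg : N ≤ algorithm1 a (b + w) (2 * w) N) (k : ℕ) (hk : k < N) (m : ℤ) : η ≤ |g k - m| := by
  have hfr := (le_algorithm1_iff a (b + w) (2 * w) N).1 halg k hk
  rw [show b + w - k * a = (b - k * a) + w by ring] at hfr
  have hseg := le_abs_sub_int_of_le_fract hfr m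
  have htri : |b - k * a - m| ≤ |g k - m| + |g k - (b - k * a)| := by
    calc |b - k * a - m| = |(g k - m) - (g k - (b - k * a))| := by ring_nf
      _ ≤ |g k - m| + |g k - (b - k * a)| := abs_sub _ _
  linarith [happrox k hk]

/-- In particular (the exact segment, `δ = 0`): if Algorithm 1 with intercept `b + w` and threshold `2w`
reports no point, every `b − k·a`, `k < N`, is at distance `≥ w` from `ℤ`. [cite: Lefevre2005, §2.3] -/
theorem le_abs_sub_int_of_algorithm1_self {a b w : K} {N : ℕ}
    (halg : N ≤ algorithm1 a (b + w) (2 * w) N) (k : ℕ) (hk : k < N) (m : ℤ) : w ≤ |b - k * a - m| :=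
  le_abs_sub_int_of_algorithm1 (g := fun k : ℕ => b - k * a) (δ := 0)
    (fun k _ => by simp) (by simp) halg k hk m

end SubDomain

section RatCast

/-- **Rational data, any ordered field** (in particular `ℝ`): the no-point verdict of Algorithm 1 on rational
inputs is the same whether it is run in `ℚ` or, on the cast inputs, in `K` — both are equivalent to
`∀ k < N, d₀ ≤ {b − k·a}` (`le_algorithm1_iff`), and `{·}` commutes with `ℚ ↪ K`. So `decide` over `ℚ`
certifies the hypothesis of `le_abs_sub_int_of_algorithm1` for REAL-valued functions ("the inputs should
properly be rounded … so that the operations are performed exactly" — here they are exact rationals).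
[cite: Lefevre2005, §2.4] -/
theorem le_algorithm1_ratCast_iff (a b d₀ : ℚ) (N : ℕ) :
    N ≤ algorithm1 (a : K) (b : K) (d₀ : K) N ↔ N ≤ algorithm1 a b d₀ N := by
  rw [le_algorithm1_iff, le_algorithm1_iff]
  refine forall₂_congr fun k _ => ?_
  rw [show (b : K) - (k : K) * (a : K) = ((b - k * a : ℚ) : K) by push_cast; ring, ← Rat.cast_fract,
    Rat.cast_le]

end RatCast

/-- End-to-end instance in `ℝ`: among the real numbers `0x243F6A8885A308D3/2^64 − k·0x9E3779B97F4A7C15/2^64`,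
`k < 2^16`, none is within `2^(-31)` of an integer — certified by running Algorithm 1 in `ℚ` (`decide`) and
transporting the verdict along `ℚ ↪ ℝ`. [cite: Lefevre2005, §2.3 Algorithm 1] -/
example : ∀ k : ℕ, k < 2 ^ 16 → ∀ m : ℤ,
    (((1 / 2 ^ 31 : ℚ)) : ℝ) ≤ |(((0x243F6A8885A308D3 / 2 ^ 64 : ℚ)) : ℝ)
      - k * (((0x9E3779B97F4A7C15 / 2 ^ 64 : ℚ)) : ℝ) - m| := by
  have h : 2 ^ 16 ≤ algorithm1 (((0x9E3779B97F4A7C15 / 2 ^ 64 : ℚ)) : ℝ)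
      ((((0x243F6A8885A308D3 / 2 ^ 64 + 1 / 2 ^ 31 : ℚ)) : ℝ))
      (((2 * (1 / 2 ^ 31) : ℚ)) : ℝ) (2 ^ 16) :=
    (le_algorithm1_ratCast_iff _ _ _ _).2 (by decide +kernel)
  rw [Rat.cast_add, Rat.cast_mul, Rat.cast_ofNat] at h
  exact le_abs_sub_int_of_algorithm1_self h

end Literature.ComputerArithmetic.Lefevre2005
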